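import Mathlib.Algebra.Order.BigOperators.Group.Finset
import Mathlib.Algebra.BigOperators.Ring.Finset
import Mathlib.Tactic
import HarnessLib

/-!
# GRH arm (rh-explicit, venture WeilGRH): Kronecker-substitution dot products for the kernel
  (engine brick of the format-C χ-cell lane, weil-grh-2 gen15 — the Schur column sums of a cell in ONE big-integer product per pair)

RE-LAND NOTE (weil-grh-2 gen16, 2026-08-25): docstring-only re-submission of p389366 to re-trigger the hub olean build that batch time-outs kept dropping
(digest build events «killed: timeout», attempts ≥ 9); every declaration below is byte-identical to the accepted p389366.

Cell `rh-explicit`, WEIL TRACK — GRH ARM (engine seat weil-grh-2 gen15).  The cell checkers of the twisted format-C lane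
(`TwistedGramCellCheckC.checkCellCRows`, door CO likewise) spend almost all their kernel time in the Schur column sums
`Σ_c M(i,c) M(i',c)/w_c`: `(2B−1)² · 2(B₃−B)` interval products (`38 000` for a `(12,48)` cell, `244 000` for `(22,88)`), each a
dozen `whnf` steps on 256-bit boxes, and the kernel's memoisation of every intermediate result is what trips its memory guard.
This file replaces the `O(n)` products per pair by ONE product of two packed naturals (Kronecker substitution,
[cite: vzGG2013, §8.4 (Kronecker substitution)]): for digit lists `x, y` (entries `< β`, common length `n ≥ 1`, base `B ≥ nβ²`)
`packLE B x = Σ_c x_c B^c`, `packBE B y = Σ_c y_c B^{n−1−c}` and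
  `packLE B x · packBE B y = lo + (Σ_c x_c y_c)·B^{n−1} + hi·B^n`, `lo < B^{n−1}`, `Σ_c x_c y_c < B`
(`pack_mul_pack`, `kLo_lt`, `dotN_lt`), hence ★ `extract_eq_dotN`: `(packLE B x · packBE B y / B^{n−1}) % B = Σ_c x_c y_c`.
Signed rows `a` (with `|a_c| < O`) are shifted to digits `a_c + O < 2O` (`digitsOf`); ★ `kronDot_eq`:
`kronDot B O (mkKRow B O a) (mkKRow B O b) = dotZ a b` where a `KRow` carries the two packs, the digit sum and the length of a
row — computed ONCE per row, so a whole Gram/Schur matrix of dot products costs one `ℕ` product, one division and one `%` per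
PAIR in the kernel (GMP-backed), independently of `n`.  Pure `ℕ`/`ℤ` arithmetic; everything proved; no axioms beyond the
standard three.  References: J. von zur Gathen, J. Gerhard, Modern Computer Algebra (3rd ed., 2013) §8.4 [vzGG2013];
R. E. Moore (1966) Ch. 3 [Moore1966] (the consumer: interval Schur complements in `TwistedGramCellCheckCK`).
-/

set_option autoImplicit false

namespace Summit.Ventures.WeilGRH

namespace Kron

/-! ## Packing, dot products, and the low/high parts of a packed product -/

/-- Little-endian base-`B` value `Σ_c x_c B^c`. [cite: vzGG2013, §8.4 (Kronecker substitution)] -/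
def packLE (B : ℕ) : List ℕ → ℕ
  | [] => 0
  | x :: xs => x + B * packLE B xs

/-- Big-endian base-`B` value `Σ_c y_c B^{n−1−c}` (`n` = length). [cite: vzGG2013, §8.4 (Kronecker substitution)] -/
def packBE (B : ℕ) : List ℕ → ℕ
  | [] => 0
  | y :: ys => y * B ^ ys.length + packBE B ys

/-- Accumulator (left-fold Horner) evaluation `acc·B^n + packBE B ys` — the form the kernel evaluates (no powers, one
growing accumulator; `packLE` is obtained from the reversed list). [cite: vzGG2013, §8.4 (Kronecker substitution)] -/
def packAcc (B : ℕ) : ℕ → List ℕ → ℕ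
  | acc, [] => acc
  | acc, y :: ys => packAcc B (acc * B + y) ys

/-- Truncating dot product on `ℕ`. [folklore] -/
def dotN : List ℕ → List ℕ → ℕ
  | x :: xs, y :: ys => x * y + dotN xs ys
  | _, _ => 0

/-- Sum of a list of naturals (structural). [folklore] -/
def sumL : List ℕ → ℕ
  | [] => 0
  | x :: xs => x + sumL xs

/-- Geometric sum `Σ_{j<k} B^j`. [folklore] -/
def geom (B : ℕ) : ℕ → ℕ
  | 0 => 0
  | k + 1 => geom B k + B ^ k

/-- The part of `packLE B x · packBE B y` below `B^{n−1}`. [cite: vzGG2013, §8.4 (Kronecker substitution)] -/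
def kLo (B : ℕ) : List ℕ → List ℕ → ℕ
  | x :: xs, _ :: ys => x * packBE B ys + B * kLo B xs ys
  | _, _ => 0

/-- The part of `packLE B x · packBE B y` from `B^n` on. [cite: vzGG2013, §8.4 (Kronecker substitution)] -/
def kHi (B : ℕ) : List ℕ → List ℕ → ℕ
  | _ :: xs, y :: ys => packLE B xs * y + kHi B xs ys
  | _, _ => 0

/-- ★ The product of the two packs splits as `lo + (x·y)·B^{n−1} + hi·B^n` (pure algebra, any `B`).
[cite: vzGG2013, §8.4 (Kronecker substitution)] -/
theorem pack_mul_pack (B : ℕ) : ∀ (xs ys : List ℕ), xs.length = ys.length →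
    packLE B xs * packBE B ys = kLo B xs ys + dotN xs ys * B ^ (xs.length - 1) + kHi B xs ys * B ^ xs.length
  | [], [], _ => by simp [packLE, packBE, kLo, dotN, kHi]
  | [], _ :: _, h => by simp at h
  | _ :: _, [], h => by simp at h
  | x :: xs, y :: ys, h => by
      have hl : xs.length = ys.length := by simpa using h
      have ih := pack_mul_pack B xs ys hl
      simp only [packLE, packBE, kLo, dotN, kHi, List.length_cons, Nat.add_sub_cancel]
      rcases Nat.eq_zero_or_pos xs.length with h0 | hpos
      · have hx : xs = [] := List.eq_nil_of_length_eq_zero h0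
        have hy : ys = [] := List.eq_nil_of_length_eq_zero (hl ▸ h0)
        subst hx; subst hy
        simp [packLE, packBE, kLo, dotN, kHi]
      · obtain ⟨k, hk⟩ : ∃ k, xs.length = k + 1 := ⟨xs.length - 1, by omega⟩
        rw [hk, Nat.add_sub_cancel] at ih
        rw [← hl, hk]
        have e : (x + B * packLE B xs) * (y * B ^ (k + 1) + packBE B ys) =
            x * y * B ^ (k + 1) + x * packBE B ys + packLE B xs * y * B ^ (k + 1 + 1) + B * (packLE B xs * packBE B ys) := by
          ring
        rw [e, ih]; ring

/-- `packAcc B acc ys = acc·B^{|ys|} + packBE B ys`. [folklore] -/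
theorem packAcc_eq (B : ℕ) : ∀ (acc : ℕ) (ys : List ℕ), packAcc B acc ys = acc * B ^ ys.length + packBE B ys
  | acc, [] => by simp [packAcc, packBE]
  | acc, y :: ys => by
      rw [packAcc, packAcc_eq B (acc * B + y) ys]
      simp only [packBE, List.length_cons, pow_succ]
      ring

/-- `packBE B (l ++ [x]) = packBE B l · B + x`. [folklore] -/
theorem packBE_append_singleton (B x : ℕ) : ∀ l : List ℕ, packBE B (l ++ [x]) = packBE B l * B + x
  | [] => by simp [packBE]
  | y :: l => by
      rw [List.cons_append, packBE, packBE, packBE_append_singleton B x l]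
      simp only [List.length_append, List.length_cons, List.length_nil, pow_succ]
      ring

/-- `packLE B xs = packBE B xs.reverse`. [folklore] -/
theorem packLE_eq_packBE_reverse (B : ℕ) : ∀ xs : List ℕ, packLE B xs = packBE B xs.reverse
  | [] => by simp [packLE, packBE]
  | x :: xs => by
      rw [packLE, packLE_eq_packBE_reverse B xs, List.reverse_cons, packBE_append_singleton]
      ring

/-! ## Bounds -/

/-- `(B−1)·Σ_{j<k} B^j + 1 = B^k` (`B ≥ 1`). [folklore] -/
theorem geom_mul_add_one {B : ℕ} (hB : 1 ≤ B) (k : ℕ) : (B - 1) * geom B k + 1 = B ^ k := by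
  obtain ⟨B', rfl⟩ : ∃ B', B = B' + 1 := ⟨B - 1, by omega⟩
  simp only [Nat.add_sub_cancel]
  induction k with
  | zero => simp [geom]
  | succ k ih =>
      simp only [geom]
      have : B' * (geom (B' + 1) k + (B' + 1) ^ k) + 1 = (B' * geom (B' + 1) k + 1) + B' * (B' + 1) ^ k := by ring
      rw [this, ih]; ring

/-- `B·Σ_{j<k} B^j ≤ Σ_{j<k+1} B^j`. [folklore] -/
theorem mul_geom_le (B k : ℕ) : B * geom B k ≤ geom B (k + 1) := by
  induction k with
  | zero => simp [geom]
  | succ k ih =>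
      have e1 : B * geom B (k + 1) = B * geom B k + B ^ (k + 1) := by simp only [geom]; ring
      have e2 : geom B (k + 1 + 1) = geom B (k + 1) + B ^ (k + 1) := by simp only [geom]
      rw [e1, e2]; omega

/-- `packBE B y ≤ (β−1)·Σ_{j<n} B^j` for digits `< β`. [folklore] -/
theorem packBE_le {B β : ℕ} : ∀ ys : List ℕ, (∀ y ∈ ys, y < β) → packBE B ys ≤ (β - 1) * geom B ys.length
  | [], _ => by simp [packBE]
  | y :: ys, h => by
      simp only [packBE, geom, List.length_cons]
      have hy : y ≤ β - 1 := Nat.le_sub_one_of_lt (h y (by simp))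
      have ih := packBE_le (B := B) ys (fun z hz ↦ h z (by simp [hz]))
      calc y * B ^ ys.length + packBE B ys ≤ (β - 1) * B ^ ys.length + (β - 1) * geom B ys.length :=
            add_le_add (Nat.mul_le_mul_right _ hy) ih
        _ = (β - 1) * (geom B ys.length + B ^ ys.length) := by ring

/-- `dotN x y ≤ n·(β−1)²` for digits `< β`. [folklore] -/
theorem dotN_le {β : ℕ} : ∀ xs ys : List ℕ, (∀ x ∈ xs, x < β) → (∀ y ∈ ys, y < β) →
    dotN xs ys ≤ xs.length * (β - 1) ^ 2
  | [], _, _, _ => by simp [dotN]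
  | _ :: _, [], _, _ => by simp [dotN]
  | x :: xs, y :: ys, hx, hy => by
      simp only [dotN, List.length_cons]
      have hx' : x ≤ β - 1 := Nat.le_sub_one_of_lt (hx x (by simp))
      have hy' : y ≤ β - 1 := Nat.le_sub_one_of_lt (hy y (by simp))
      have ih := dotN_le xs ys (fun z hz ↦ hx z (by simp [hz])) (fun z hz ↦ hy z (by simp [hz]))
      have hxy : x * y ≤ (β - 1) ^ 2 := by rw [sq]; exact Nat.mul_le_mul hx' hy'
      nlinarith

/-- `kLo B x y ≤ (n−1)·β²·Σ_{j<n−1} B^j` for digits `< β`, equal lengths `n`. [folklore] -/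
theorem kLo_le {B β : ℕ} : ∀ xs ys : List ℕ, xs.length = ys.length → (∀ x ∈ xs, x < β) → (∀ y ∈ ys, y < β) →
    kLo B xs ys ≤ (xs.length - 1) * β ^ 2 * geom B (xs.length - 1)
  | [], _, _, _, _ => by simp [kLo]
  | _ :: _, [], h, _, _ => by simp at h
  | x :: xs, y :: ys, hl, hx, hy => by
      have hl' : xs.length = ys.length := by simpa using hl
      simp only [kLo, List.length_cons, Nat.add_sub_cancel]
      have hxβ : x < β := hx x (by simp)
      have ih := kLo_le (B := B) xs ys hl' (fun z hz ↦ hx z (by simp [hz])) (fun z hz ↦ hy z (by simp [hz]))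
      have hQ := packBE_le (B := B) ys (fun z hz ↦ hy z (by simp [hz]))
      rw [← hl'] at hQ
      rcases Nat.eq_zero_or_pos xs.length with h0 | hpos
      · have hxn : xs = [] := List.eq_nil_of_length_eq_zero h0
        have hyn : ys = [] := List.eq_nil_of_length_eq_zero (hl' ▸ h0)
        subst hxn; subst hyn
        simp [kLo, packBE]
      · obtain ⟨k, hk⟩ : ∃ k, xs.length = k + 1 := ⟨xs.length - 1, by omega⟩
        rw [hk] at ih hQ ⊢
        try rw [Nat.add_sub_cancel] at ih
        -- `x · packBE ys ≤ β² · geom (k+1)` and `B · kLo xs ys ≤ k β² geom (k+1)`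
        have h1 : x * packBE B ys ≤ β ^ 2 * geom B (k + 1) := by
          have : x * packBE B ys ≤ β * ((β - 1) * geom B (k + 1)) := Nat.mul_le_mul hxβ.le hQ
          calc x * packBE B ys ≤ β * ((β - 1) * geom B (k + 1)) := this
            _ ≤ β * (β * geom B (k + 1)) := by gcongr; omega
            _ = β ^ 2 * geom B (k + 1) := by ring
        have h2 : B * kLo B xs ys ≤ k * β ^ 2 * geom B (k + 1) := by
          calc B * kLo B xs ys ≤ B * (k * β ^ 2 * geom B k) := Nat.mul_le_mul_left B ih
            _ = k * β ^ 2 * (B * geom B k) := by ring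
            _ ≤ k * β ^ 2 * geom B (k + 1) := Nat.mul_le_mul_left _ (mul_geom_le B k)
        calc x * packBE B ys + B * kLo B xs ys ≤ β ^ 2 * geom B (k + 1) + k * β ^ 2 * geom B (k + 1) := add_le_add h1 h2
          _ = (k + 1) * β ^ 2 * geom B (k + 1) := by ring

/-- `lo < B^{n−1}` when `nβ² ≤ B` (`n ≥ 1`, `β ≥ 1`). [cite: vzGG2013, §8.4 (Kronecker substitution)] -/
theorem kLo_lt {B β : ℕ} {xs ys : List ℕ} (hl : xs.length = ys.length) (hx : ∀ x ∈ xs, x < β) (hy : ∀ y ∈ ys, y < β)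
    (hβ : 1 ≤ β) (hB : xs.length * β ^ 2 ≤ B) : kLo B xs ys < B ^ (xs.length - 1) := by
  have h := kLo_le (B := B) xs ys hl hx hy
  have hβ2 : 1 ≤ β ^ 2 := Nat.one_le_pow _ _ hβ
  rcases Nat.eq_zero_or_pos xs.length with h0 | hpos
  · rw [h0] at h ⊢
    simp only [zero_tsub, zero_mul, nonpos_iff_eq_zero, pow_zero] at h ⊢
    omega
  · obtain ⟨k, hk⟩ : ∃ k, xs.length = k + 1 := ⟨xs.length - 1, by omega⟩
    rw [hk, Nat.add_sub_cancel] at h ⊢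
    rw [hk] at hB
    have hB1 : 1 ≤ B := by nlinarith
    have hkβ : k * β ^ 2 ≤ B - 1 := by
      have : k * β ^ 2 + β ^ 2 = (k + 1) * β ^ 2 := by ring
      omega
    have hg := geom_mul_add_one hB1 k
    calc kLo B xs ys ≤ k * β ^ 2 * geom B k := h
      _ ≤ (B - 1) * geom B k := Nat.mul_le_mul_right _ hkβ
      _ < B ^ k := by omega

/-- `x·y < B` when `nβ² ≤ B`, `n ≥ 1`. [folklore] -/
theorem dotN_lt {B β : ℕ} {xs ys : List ℕ} (hx : ∀ x ∈ xs, x < β) (hy : ∀ y ∈ ys, y < β)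
    (hn : 0 < xs.length) (hB : xs.length * β ^ 2 ≤ B) : dotN xs ys < B := by
  have h := dotN_le xs ys hx hy
  have hβ : 1 ≤ β := by
    match xs, hn with
    | x :: _, _ => exact Nat.one_le_of_lt (hx x (by simp))
  have hlt : (β - 1) ^ 2 < β ^ 2 := Nat.pow_lt_pow_left (by omega) (by norm_num)
  calc dotN xs ys ≤ xs.length * (β - 1) ^ 2 := h
    _ < xs.length * β ^ 2 := Nat.mul_lt_mul_of_pos_left hlt hn
    _ ≤ B := hB

/-- ★ **Kronecker extraction**: `(packLE B x · packBE B y / B^{n−1}) % B = Σ_c x_c y_c` for digit lists of equal length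
`n ≥ 1` with entries `< β` and `nβ² ≤ B`. [cite: vzGG2013, §8.4 (Kronecker substitution)] -/
theorem extract_eq_dotN {B β : ℕ} {xs ys : List ℕ} (hl : xs.length = ys.length) (hn : 0 < xs.length)
    (hx : ∀ x ∈ xs, x < β) (hy : ∀ y ∈ ys, y < β) (hB : xs.length * β ^ 2 ≤ B) :
    packLE B xs * packBE B ys / B ^ (xs.length - 1) % B = dotN xs ys := by
  have hβ : 1 ≤ β := by
    match xs, hn with
    | x :: _, _ => exact Nat.one_le_of_lt (hx x (by simp))
  have hlo := kLo_lt (B := B) hl hx hy hβ hB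
  have hD := dotN_lt (B := B) hx hy hn hB
  obtain ⟨k, hk⟩ : ∃ k, xs.length = k + 1 := ⟨xs.length - 1, by omega⟩
  have hprod := pack_mul_pack B xs ys hl
  rw [hk, Nat.add_sub_cancel] at hprod hlo ⊢
  have hBk : 0 < B ^ k := Nat.pos_of_ne_zero (by
    intro h0; rw [h0] at hlo; exact Nat.not_lt_zero _ hlo)
  have e : packLE B xs * packBE B ys = kLo B xs ys + B ^ k * (dotN xs ys + B * kHi B xs ys) := by
    rw [hprod]; ring
  rw [e, Nat.add_mul_div_left _ _ hBk, Nat.div_eq_of_lt hlo, zero_add, Nat.add_mul_mod_self_left,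
    Nat.mod_eq_of_lt hD]

/-! ## Signed rows: shift by `O`, one record per row -/

/-- Digits of a signed row: `a ↦ (a + O).toNat`. [folklore] -/
def digitsOf (O : ℕ) : List ℤ → List ℕ
  | [] => []
  | a :: as => (a + O).toNat :: digitsOf O as

/-- Truncating dot product on `ℤ`. [folklore] -/
def dotZ : List ℤ → List ℤ → ℤ
  | a :: as, b :: bs => a * b + dotZ as bs
  | _, _ => 0

/-- `|a| < O` for every entry (kernel check). [folklore] -/
def smallAll (O : ℕ) : List ℤ → Bool
  | [] => true
  | a :: as => decide (a.natAbs < O) && smallAll O as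

/-- The per-row record: the two packs of the digits, their sum, and the length. [cite: vzGG2013, §8.4 (Kronecker substitution)] -/
structure KRow where
  /-- `packLE B digits` -/
  pLE : ℕ
  /-- `packBE B digits` -/
  pBE : ℕ
  /-- digit sum -/
  sd : ℕ
  /-- length -/
  n : ℕ
  deriving Inhabited

/-- Build the record of a signed row. [cite: vzGG2013, §8.4 (Kronecker substitution)] -/
def mkKRow (B O : ℕ) (as : List ℤ) : KRow :=
  let ds := digitsOf O as
  ⟨packAcc B 0 ds.reverse, packAcc B 0 ds, sumL ds, as.length⟩

/-- The Kronecker dot product of two records: ONE product, one division, one `%`, then the un-shift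
`Σ (x−O)(y−O) = Σ xy − O(Σx + Σy) + nO²`. [cite: vzGG2013, §8.4 (Kronecker substitution)] -/
def kronDot (B O : ℕ) (X Y : KRow) : ℤ :=
  ((X.pLE * Y.pBE / B ^ (X.n - 1) % B : ℕ) : ℤ) - (O : ℤ) * ((X.sd + Y.sd : ℕ) : ℤ) + (X.n : ℤ) * (O : ℤ) ^ 2

/-- Lengths. [folklore] -/
theorem length_digitsOf (O : ℕ) : ∀ as : List ℤ, (digitsOf O as).length = as.length
  | [] => rfl
  | _ :: as => by simp [digitsOf, length_digitsOf O as]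

/-- What `smallAll` certifies. [folklore] -/
theorem smallAll_spec {O : ℕ} : ∀ {as : List ℤ}, smallAll O as = true → ∀ a ∈ as, a.natAbs < O
  | [], _, a, ha => by simp at ha
  | b :: bs, h, a, ha => by
      simp only [smallAll, Bool.and_eq_true, decide_eq_true_eq] at h
      rcases List.mem_cons.mp ha with rfl | ha'
      · exact h.1
      · exact smallAll_spec h.2 a ha'

/-- Digits are `< 2O`. [folklore] -/
theorem digitsOf_lt {O : ℕ} : ∀ {as : List ℤ}, (∀ a ∈ as, a.natAbs < O) → ∀ x ∈ digitsOf O as, x < 2 * O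
  | [], _, x, hx => by simp [digitsOf] at hx
  | a :: as, h, x, hx => by
      simp only [digitsOf, List.mem_cons] at hx
      rcases hx with rfl | hx'
      · have ha := h a (by simp)
        have : a + O < 2 * O := by omega
        omega
      · exact digitsOf_lt (fun b hb ↦ h b (by simp [hb])) x hx'

/-- The shifted identity `dotZ a b = dotN x y − O(Σx + Σy) + nO²` (`x = a + O`, `y = b + O`). [folklore] -/
theorem dotZ_eq_digits {O : ℕ} : ∀ (as bs : List ℤ), as.length = bs.length → (∀ a ∈ as, a.natAbs < O) →
    (∀ b ∈ bs, b.natAbs < O) →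
    dotZ as bs = ((dotN (digitsOf O as) (digitsOf O bs) : ℕ) : ℤ)
      - (O : ℤ) * ((sumL (digitsOf O as) + sumL (digitsOf O bs) : ℕ) : ℤ) + (as.length : ℤ) * (O : ℤ) ^ 2
  | [], [], _, _, _ => by simp [dotZ, dotN, digitsOf, sumL]
  | [], _ :: _, h, _, _ => by simp at h
  | _ :: _, [], h, _, _ => by simp at h
  | a :: as, b :: bs, hl, ha, hb => by
      have hl' : as.length = bs.length := by simpa using hl
      have ih := dotZ_eq_digits as bs hl' (fun z hz ↦ ha z (by simp [hz])) (fun z hz ↦ hb z (by simp [hz]))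
      have ha0 : 0 ≤ a + O := by have := ha a (by simp); omega
      have hb0 : 0 ≤ b + O := by have := hb b (by simp); omega
      simp only [dotZ, dotN, digitsOf, sumL, List.length_cons]
      push_cast
      rw [Int.toNat_of_nonneg ha0, Int.toNat_of_nonneg hb0, ih]
      push_cast
      ring

/-- ★★ **The Kronecker dot product is the dot product**: for signed rows of equal length `n ≥ 1` with `|entries| < O` and
`n·(2O)² ≤ B`, `kronDot B O (mkKRow B O a) (mkKRow B O b) = dotZ a b`. [cite: vzGG2013, §8.4 (Kronecker substitution)] -/
theorem kronDot_eq {B O : ℕ} {as bs : List ℤ} (hl : as.length = bs.length) (hn : 0 < as.length)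
    (ha : ∀ a ∈ as, a.natAbs < O) (hb : ∀ b ∈ bs, b.natAbs < O) (hB : as.length * (2 * O) ^ 2 ≤ B) :
    kronDot B O (mkKRow B O as) (mkKRow B O bs) = dotZ as bs := by
  have hlx : (digitsOf O as).length = (digitsOf O bs).length := by rw [length_digitsOf, length_digitsOf, hl]
  have hnx : 0 < (digitsOf O as).length := by rw [length_digitsOf]; exact hn
  have hBx : (digitsOf O as).length * (2 * O) ^ 2 ≤ B := by rw [length_digitsOf]; exact hB
  have hex := extract_eq_dotN hlx hnx (digitsOf_lt ha) (digitsOf_lt hb) hBx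
  rw [length_digitsOf] at hex
  unfold kronDot mkKRow
  simp only [packAcc_eq, zero_mul, zero_add, ← packLE_eq_packBE_reverse]
  rw [hex, dotZ_eq_digits as bs hl ha hb]

end Kron

end Summit.Ventures.WeilGRH
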